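import Summits.BirchSwinnertonDyer.BirchSwinnertonDyer.Theorems.ClassRecordThreeCornerTwistWitnessReplays
import Summits.BirchSwinnertonDyer.BirchSwinnertonDyer.Theorems.ClassRecordThreeKernelUpperB
import Summits.BirchSwinnertonDyer.BirchSwinnertonDyer.Theorems.ClassRecordThreeCornerAtThreeUpperShimuraDefs
import HarnessLib

/-!
# Routes `ClassRecordThree` / `KolyvaginRoadThree` (rung K2@3), crux `CornerAtThreeW` (item stmt-BirchSwinnertonDyer-21420): the two
# `closes` kernels with the corner's UPPER conjunct RE-CUT to its CONSUMER SHAPE `Theorems.CornerAtThreeUpperConsumed` (U′) —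
# one-token twins of mult-p3 g4's `ClassRecordThreeCornerTwistWitnessKernel` (cell `bsd-stepL`, seat `bsd-stepL-corner3-p2` g5 =
# WIDTH-LEVER lane B; `--supports stmt-BirchSwinnertonDyer-21420 --as helper`)

Theorems only; no definition, no named fact, no `sorry`; imports NO Theses file and NO `Cruxes/` file (import closure checked:
`…UpperShimuraDefs` is Theses-free). NO new mathematics beyond the originals.

## What this file does (and why — plan g37 RULING 39 «witness-shaped r2»)

mult-p3's kernels `multiplicativeRankOneAtThree_of_{classRecord,kolyRecord}_upperB_of_twistWitness` (p559530) take the corner's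
upper conjunct as `hCU : ∀ W, X11b.Three.CornerUpperAt W` (the Tamagawa-SHARP bound over EVERY classical Heegner frame) and use it
at exactly ONE site each — inside `fun ht ↦ CornerTwistWitness.missingUpperBoundAt_of_cornerUpperAt_of_cornerTwistWitnessAt … ht
(hCU W) (hCW W)`, i.e. only to produce the CONSUMER SHAPE `3 ∣ ∏c → Typed.MissingUpperBoundAt W 3`. Here `hCU` ↦
`hCU' : Theorems.CornerAtThreeUpperConsumed` (`∀ W, ClassX11b W 3 → ¬ Surj W 3 → 3 ∣ ∏c → Typed.MissingUpperBoundAt W 3`,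
the `Prop` constant of `ClassRecordThreeCornerAtThreeUpperShimuraDefs.lean`, p554046) and that lambda ↦ `fun ht ↦ hCU' W hX hsurj ht`;
every other token VERBATIM:
* §1 `multiplicativeRankOneAtThree_of_classRecord_upperConsumed_of_twistWitness`;
* §2 `multiplicativeRankOneAtThree_of_kolyRecord_upperConsumed_of_twistWitness`.
WHY: RULING 39 proposes the witness-shaped reshape r2 of the 21420 line (`stub_cornerTwistLower3 + stub_cornerTwistMuAn3` ↦ ONE
`stub_cornerTwistWitness3`). But the line derives the crux's (U) = `∀ W, CornerUpperAt W` from the inert road ONLY through the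
CONVERSE bridge `cornerAtThreeUpper_of_consumed_of_twist` (corner3-p2 g4, p553450), which needs `CornerTwistAt W` at EVERY Heegner
frame (the Tamagawa-sharp bound at a frame `K` is the consumer shape for `E` plus the twin's lower bound AT `K`) — a single witness
frame does not give it. What the inert road proves WITHOUT any twist input is U′ (`cornerUpperConsumed3_of_inertStubs` of
`Lines/inert.lean`, from {19616 (7), display D, x11aLowerHalf@3, residual}; conjuncts D and (7) are now kernel theorems modulo named
print, p577140). So a witness-shaped line closes a crux whose upper conjunct is U′, and these two kernels are the `closes` terms of
that re-cut (`CornerAtThreeW′ := ∀ W, CornerStepLAt W ∧ CornerTwistWitnessAt W ∧ (ClassX11b W 3 → ¬ Surj W 3 → 3 ∣ ∏c →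
MissingUpperBoundAt W 3)`; U′ is WEAKER than U — `missingUpperBoundAt_of_cornerUpperAt_of_cornerTwistWitnessAt` — so the re-cut only
weakens the crux). Whether to re-cut is the planner's ∕ director's call; this file makes it a one-token edit.

HONEST FRAMING: kernel re-plumbing; CONDITIONAL on every binder (named published facts + the routes' typed inputs); nothing booked;
no census word, tier or label moves (T7); O2 stays OPEN; BSD(E,3) is proved for no class by this file.
References: those of `ClassRecordThreeCornerTwistWitnessKernel.lean` ∕ `ClassRecordThreeKernelUpperB.lean` — [Castella2018] Thm. 2.3,
Thm. 3.2, §5; [Skinner2016PacificMC] Thm. A, Thm. C; [SteinWuthrich2013] Thm. 6.1; [Disegni2020] Thm. 1; [MatarNekovar2019] Thm. 0.3;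
[Hsieh2014] Thm. 1; [McCallumLMS1991] Cor. 5.6; [Wuthrich2014] Prop. 21; cell board RULING 39 (2026-08-27T21:58Z).
presearch: n/a — one-token re-plumbing of a landed kernel.
-/

noncomputable section

open scoped Classical

open WeierstrassCurve NumberField IsDedekindDomain Field Literature.NumberTheory.EllipticCurves
  Rat.HeightOneSpectrum
  Literature.NumberTheory.DiophantineGeometry
  Literature.NumberTheory.EllipticCurves.GreenbergSelmer
  Literature.NumberTheory.EllipticCurves.ModularForms
  Literature.NumberTheory.EllipticCurves.Rank1Residual
  Literature.NumberTheory.EllipticCurves.Rank1Residual.Typed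
  Literature.NumberTheory.EllipticCurves.Wuthrich2014
  Literature.NumberTheory.EllipticCurves.BalakrishnanEtAl2019
  Literature.NumberTheory.EllipticCurves.Skinner2016
  Literature.NumberTheory.EllipticCurves.SteinWuthrich2013
  Literature.NumberTheory.EllipticCurves.Disegni2020
  Literature.NumberTheory.EllipticCurves.BarriosEtAl2025
  Literature.NumberTheory.QuadraticFields.Quadratic
  Literature.NumberTheory.Automorphic
  Literature.NumberTheory.GaloisRepresentations Literature.NumberTheory.GaloisCohomology
  Summit.BirchSwinnertonDyer.Rank1Residual.X11b.AcSelmer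
  Summit.BirchSwinnertonDyer.Rank1Residual.X11b.LocBridge
  Summit.BirchSwinnertonDyer.Rank1Residual
  Summit.BirchSwinnertonDyer.Rank1Residual.X11b
  Summit.BirchSwinnertonDyer.Rank1Residual.X11b.Three

-- the cell's Theorems namespace repeats the summit name (Summit.<Summit>.<Problem>), as in every sibling file
set_option linter.dupNamespace false

namespace Summit.BirchSwinnertonDyer.BirchSwinnertonDyer.Theorems

/-! ### §1. The K2@3 `closes` kernel from the class record, corner re-glued through the twin WITNESS -/

/-- **K2@3 `closes` kernel from the class record (H3 ORIENTED), with the corner's (Tw) conjunct RE-CUT to ONE twin.**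
`multiplicativeRankOneAtThree_of_classRecord_upperB` VERBATIM except that the corner binder
`hCT : ∀ W, X11b.Three.CornerTwistAt W` (the rank-`0` `3`-part of BSD for EVERY odd Heegner twist) is replaced by
`hCW : ∀ W, CornerTwistWitness.CornerTwistWitnessAt W` (ONE odd Heegner twin per corner pair, `d_K < -4`, `3` split,
`L(E^{d_K},1) ≠ 0`, `BSDp Wd 3` — STRICTLY WEAKER, `CornerTwistWitness.cornerTwistWitnessAt_of_cornerTwistAt`), and the
corner branch (`¬Ram ∧ ¬Surj`) is ONE call of `CornerTwistWitness.missingPPartAt_of_corner_of_witness` at the witness (STEP L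
`hCL`, (U♯) `hCU'` = the consumer shape `CornerAtThreeUpperConsumed` directly, Matar–Nekovář
`hMN` off the Tamagawa cells) — the split(3) dichotomy of the pass-through wrappers `…_split_of_inputs` ∕ `…_nonsplit_of_inputs`
is not needed. Roads (a), (b), (d) and every other binder byte-identical. CONDITIONAL on every binder; nothing booked;
O2 OPEN; no census word, tier or label moves.
-- adapted from Summits/BirchSwinnertonDyer/BirchSwinnertonDyer/Theorems/ClassRecordThreeKernelUpperB.lean (§1)
[cite: Castella2018, Thm. 2.3 (p. 5), Thm. 3.2 (p. 9), §5 (p. 12)] [cite: Skinner2016PacificMC, Thm. A and Thm. C (§1)]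
[cite: SteinWuthrich2013, Thm. 6.1, §4.2] [cite: Disegni2020, Thm. 1 (§1.2)] [cite: MatarNekovar2019, Thm. 0.3 (p. 456)]
[cite: Hsieh2014, Thm. 1 (arXiv:1112.1580 pp. 3–4)] [cite: Wuthrich2014, Prop. 21 (p. 400)] [cite: Miller2011LMS, Def. 1.1] -/
theorem multiplicativeRankOneAtThree_of_classRecord_upperConsumed_of_twistWitness
    -- PUBLISHED: the named facts of route p2, WITHOUT `hEP` (as v4.5′)
    (hGZ : ∀ (N : ℕ) [NeZero N] (W : WeierstrassCurve ℚ) (K : Type) [Field K] [NumberField K],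
      gross_zagier N W K)
    (hKo : ∀ (N : ℕ) [NeZero N] (W : WeierstrassCurve ℚ) (K : Type) [Field K] [NumberField K],
      kolyvagin N W K)
    (hB : ∀ (N : ℕ) [NeZero N] (W : WeierstrassCurve ℚ) (K : Type) [Field K] [NumberField K],
      Kolyvagin1990_padicValNat_card_sha_le N W K)
    (hSk : Skinner2016.thmC_padicValRat_bsd_rank_zero) (hWu : sha_dvd_analyticSha)
    (hGZK : rank_eq_analyticRank_of_analyticRank_le_one) (hmod : hasEntireLFunction_rat)
    (hnf : exists_isNewformOf) (hHL : HoffsteinLuo1997_exists_twist_L_one_ne_zero)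
    (hMaz : mazur_not_dvd_maninConstant_of_odd)
    (hPT : ∀ (K : Type) [Field K] [NumberField K], poitouTate_sum_localTatePairing_eq_zero K)
    -- PUBLISHED: road (a)'s five, Matar–Nekovář 2019 Thm. 0.3, Hsieh 2014 Thm. 1 (NO `hFH`, NO `hBR`)
    (hSkA : thmA_charIdeal_multiplicative) (hJn : thm61_nonsplitMultiplicative)
    (hHn : exists_isMultCanonical) (hD : thm1_padicBSD_rankOne_multiplicative)
    (hpar : nonempty_modularParametrizationData)
    (hMN : ∀ (N : ℕ) [NeZero N] (W : WeierstrassCurve ℚ) (K : Type) [Field K] [NumberField K],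
      MatarNekovar2019.thm03_padicValNat_card_sha_le_of_irreducible N W K)
    (hH : hsieh2014_exists_anticyclotomicPAdicLFunction)
    -- ROAD (a) NONSPLIT(3) ∧ (ram): Schneider at 3
    (hReg : ∀ (W : WeierstrassCurve ℚ) [W.IsElliptic] [W.IsGloballyMinimal],
      ClassX11b W 3 → Ram W 3 → ¬ W.HasSplitMultiplicativeReductionAtPrime 3 →
        ClassClosure.RegulatorNonvanishingAt W 3)
    -- ROADS (b)/(d): the named descent residual …
    (hDb : ∀ (W : WeierstrassCurve ℚ) [W.IsElliptic] [W.IsGloballyMinimal],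
      ClassX11b W 3 → Ram W 3 → W.HasSplitMultiplicativeReductionAtPrime 3 → HsiehDescentAt₃ W)
    (hDd : ∀ (W : WeierstrassCurve ℚ) [W.IsElliptic] [W.IsGloballyMinimal],
      ClassX11b W 3 → ¬ Ram W 3 → Surj W 3 → HsiehDescentAt₃ W)
    -- … and the halves H2 ∧ H3
    (hHb : ∀ (W : WeierstrassCurve ℚ) [W.IsElliptic] [W.IsGloballyMinimal],
      ClassX11b W 3 → Ram W 3 → W.HasSplitMultiplicativeReductionAtPrime 3 →
        BDPValueAt₃ W ∧ IMCDivAt₃B W)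
    (hHd : ∀ (W : WeierstrassCurve ℚ) [W.IsElliptic] [W.IsGloballyMinimal],
      ClassX11b W 3 → ¬ Ram W 3 → Surj W 3 → BDPValueAt₃ W ∧ IMCDivAt₃B W)
    -- pure-(T2β)@3 on split ∧ (ram): the CONSUMED Euler-system half (replaces the displays binder `hSh`)
    (hUβ : ∀ (W : WeierstrassCurve ℚ) [W.IsElliptic] [W.IsGloballyMinimal],
      ClassX11b W 3 → Ram W 3 → W.HasSplitMultiplicativeReductionAtPrime 3 → ¬ ShapeAlpha W →
        ¬ ShapeGamma W → 3 ∣ W.tamagawaProduct → Typed.MissingUpperBoundAt W 3)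
    -- (T2′)₃ Euler-system halves (α, γ∖α split, ¬ram)
    (hUα : ∀ (W : WeierstrassCurve ℚ) [W.IsElliptic] [W.IsGloballyMinimal],
      ClassX11b W 3 → Ram W 3 → ShapeAlpha W → Typed.MissingUpperBoundAt W 3)
    (hUγ : ∀ (W : WeierstrassCurve ℚ) [W.IsElliptic] [W.IsGloballyMinimal],
      ClassX11b W 3 → Ram W 3 → W.HasSplitMultiplicativeReductionAtPrime 3 → ¬ ShapeAlpha W →
        ShapeGamma W → Typed.MissingUpperBoundAt W 3)
    (hU₀ : ∀ (W : WeierstrassCurve ℚ) [W.IsElliptic] [W.IsGloballyMinimal],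
      ClassX11b W 3 → Surj W 3 → ¬ Ram W 3 → Typed.MissingUpperBoundAt W 3)
    -- THE (T4″)₃ CORNER `¬Surj`
    (hCL : ∀ (W : WeierstrassCurve ℚ) [W.IsElliptic] [W.IsGloballyMinimal], CornerStepLAt W)
    (hCW : ∀ (W : WeierstrassCurve ℚ) [W.IsElliptic] [W.IsGloballyMinimal],
      CornerTwistWitness.CornerTwistWitnessAt W)
    (hCU' : CornerAtThreeUpperConsumed) :
    MultiplicativeRankOneAtThree := by
  intro W _ _ hX
  have hEP : ∀ (K : Type) [Field K] [NumberField K] (v : HeightOneSpectrum (𝓞 K)),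
      localEulerPoincareCharacteristic (v.adicCompletion K) :=
    GaloisImage.EP.localEulerPoincareCharacteristic_adicCompletion
  by_cases hram : Ram W 3
  · by_cases hs : W.HasSplitMultiplicativeReductionAtPrime 3
    · -- road (b): StepLAt W from the named descent residual + H2 ∧ H3 at W
      have hL : StepLAt W :=
        stepLAt_of_halves₃_of_classX11bB hnf hKo hPT hEP hX
          (bdpExistsAt₃_of_hsieh2014_of_descent W hH lambdaSupplyAt₃ (hDb W hX hram hs))
          (hHb W hX hram hs).1 (hHb W hX hram hs).2
      exact Three.bsdp_three_of_surj_of_stepLAt_of_shapes_upper hGZ hKo hB hSk hWu hGZK hmod hnf hHL hMaz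
        hPT hEP W hX (surj_of_irr_of_ram W 3 hX.2.2.2 hram) hL
        (fun hram hα hγ ht ↦ hUβ W hX hram hs hα hγ ht) (fun hram hα ↦ hUα W hX hram hα)
        (fun hram hα hγ ↦ hUγ W hX hram hs hα hγ) (fun h ↦ absurd hram h)
    · -- road (a)
      exact bsdp_of_ram_of_nonsplit_of_regulatorNonvanishing hSkA hJn hHn hD hGZK hpar W 3 hX hram hs
        (hReg W hX hram hs)
  · by_cases hsurj : Surj W 3
    · -- road (d)
      have hL₀ : StepLAt W :=
        stepLAt_of_halves₃_of_classX11bB hnf hKo hPT hEP hX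
          (bdpExistsAt₃_of_hsieh2014_of_descent W hH lambdaSupplyAt₃ (hDd W hX hram hsurj))
          (hHd W hX hram hsurj).1 (hHd W hX hram hsurj).2
      exact Three.bsdp_three_of_surj_of_stepLAt_of_shapes_upper hGZ hKo hB hSk hWu hGZK hmod hnf hHL hMaz
        hPT hEP W hX hsurj hL₀ (fun h _ _ _ ↦ absurd h hram) (fun h _ ↦ absurd h hram)
        (fun h _ _ ↦ absurd h hram) (fun _ ↦ hU₀ W hX hsurj hram)
    · -- the corner: ONE call at the twin WITNESS ((U♯) on the Tamagawa cells via §1's upper replay)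
      refine Typed.bsdp_of_missingPPartAt W 3 hGZK (by rw [hX.1]) ?_
      exact CornerTwistWitness.missingPPartAt_of_corner_of_witness hGZ hKo hGZK hmod hnf hMaz hPT hEP hMN W hX
        hsurj (hCL W) (hCW W) (fun ht ↦ hCU' W hX hsurj ht)

/-! ### §2. The K2@3 `closes` kernel from the KOLY record, corner re-glued through the twin WITNESS -/

/-- **K2@3 `closes` kernel from the KOLY RECORD (H3 ORIENTED), with the corner's (Tw) conjunct RE-CUT to ONE twin.**
`multiplicativeRankOneAtThree_of_kolyRecord_upperB` VERBATIM except `hCT : ∀ W, CornerTwistAt W` ↦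
`hCW : ∀ W, CornerTwistWitness.CornerTwistWitnessAt W` and the corner branch re-glued as ONE call of
`CornerTwistWitness.missingPPartAt_of_corner_of_witness` at the witness (as in §1). Every other binder byte-identical (the
Kolyvagin road `hA1` on A1; road (a) `hReg`; `hDb`, `hHb`, `hUβ`, `hUα`, `hUγ`, `hDd`, `hHd`, `hU₀`; corner `hCL`, `hCU'` = `CornerAtThreeUpperConsumed`).
CONDITIONAL on every binder; nothing booked; O2 OPEN.
-- adapted from Summits/BirchSwinnertonDyer/BirchSwinnertonDyer/Theorems/ClassRecordThreeKernelUpperB.lean (§2)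
[cite: Castella2018, Thm. 2.3 (p. 5), Thm. 3.2 (p. 9), §5 (p. 12)] [cite: Skinner2016PacificMC, Thm. A and Thm. C (§1)]
[cite: McCallumLMS1991, §5 Cor. 5.6 (p. 310)] [cite: MatarNekovar2019, Thm. 0.3 (p. 456)] -/
theorem multiplicativeRankOneAtThree_of_kolyRecord_upperConsumed_of_twistWitness
    -- PUBLISHED: the named facts of route p2, WITHOUT `hEP` (as v4.5′)
    (hGZ : ∀ (N : ℕ) [NeZero N] (W : WeierstrassCurve ℚ) (K : Type) [Field K] [NumberField K],
      gross_zagier N W K)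
    (hKo : ∀ (N : ℕ) [NeZero N] (W : WeierstrassCurve ℚ) (K : Type) [Field K] [NumberField K],
      kolyvagin N W K)
    (hB : ∀ (N : ℕ) [NeZero N] (W : WeierstrassCurve ℚ) (K : Type) [Field K] [NumberField K],
      Kolyvagin1990_padicValNat_card_sha_le N W K)
    (hSk : Skinner2016.thmC_padicValRat_bsd_rank_zero) (hWu : sha_dvd_analyticSha)
    (hGZK : rank_eq_analyticRank_of_analyticRank_le_one) (hmod : hasEntireLFunction_rat)
    (hnf : exists_isNewformOf) (hHL : HoffsteinLuo1997_exists_twist_L_one_ne_zero)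
    (hMaz : mazur_not_dvd_maninConstant_of_odd)
    (hPT : ∀ (K : Type) [Field K] [NumberField K], poitouTate_sum_localTatePairing_eq_zero K)
    -- PUBLISHED: road (a)'s five, Matar–Nekovář 2019 Thm. 0.3, Hsieh 2014 Thm. 1 (NO `hFH`, NO `hBR`)
    (hSkA : thmA_charIdeal_multiplicative) (hJn : thm61_nonsplitMultiplicative)
    (hHn : exists_isMultCanonical) (hD : thm1_padicBSD_rankOne_multiplicative)
    (hpar : nonempty_modularParametrizationData)
    (hMN : ∀ (N : ℕ) [NeZero N] (W : WeierstrassCurve ℚ) (K : Type) [Field K] [NumberField K],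
      MatarNekovar2019.thm03_padicValNat_card_sha_le_of_irreducible N W K)
    (hH : hsieh2014_exists_anticyclotomicPAdicLFunction)
    -- THE KOLYVAGIN ROAD on A1 = (ram) ∧ 3 ∤ ∏c
    (hA1 : ∀ (W : WeierstrassCurve ℚ) [W.IsElliptic] [W.IsGloballyMinimal],
      ClassX11b W 3 → Ram W 3 → ¬ 3 ∣ W.tamagawaProduct → BSDp W 3)
    -- ROAD (a) NONSPLIT(3) ∧ (ram) ∧ 3 ∣ ∏c: Schneider at 3, RESTRICTED to the Tamagawa cells
    (hReg : ∀ (W : WeierstrassCurve ℚ) [W.IsElliptic] [W.IsGloballyMinimal],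
      ClassX11b W 3 → Ram W 3 → ¬ W.HasSplitMultiplicativeReductionAtPrime 3 → 3 ∣ W.tamagawaProduct →
        ClassClosure.RegulatorNonvanishingAt W 3)
    -- ROAD (b) SPLIT(3) ∧ (ram): the named descent residual …
    (hDb : ∀ (W : WeierstrassCurve ℚ) [W.IsElliptic] [W.IsGloballyMinimal],
      ClassX11b W 3 → Ram W 3 → W.HasSplitMultiplicativeReductionAtPrime 3 → HsiehDescentAt₃ W)
    -- … and the halves H2 ∧ H3, RESTRICTED to the Tamagawa cells
    (hHb : ∀ (W : WeierstrassCurve ℚ) [W.IsElliptic] [W.IsGloballyMinimal],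
      ClassX11b W 3 → Ram W 3 → W.HasSplitMultiplicativeReductionAtPrime 3 → 3 ∣ W.tamagawaProduct →
        BDPValueAt₃ W ∧ IMCDivAt₃B W)
    -- pure-(T2β)@3 on split ∧ (ram): the CONSUMED Euler-system half (replaces the displays binder `hSh`)
    (hUβ : ∀ (W : WeierstrassCurve ℚ) [W.IsElliptic] [W.IsGloballyMinimal],
      ClassX11b W 3 → Ram W 3 → W.HasSplitMultiplicativeReductionAtPrime 3 → ¬ ShapeAlpha W →
        ¬ ShapeGamma W → 3 ∣ W.tamagawaProduct → Typed.MissingUpperBoundAt W 3)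
    -- (T2′)₃ Euler-system halves (as v4.5′)
    (hUα : ∀ (W : WeierstrassCurve ℚ) [W.IsElliptic] [W.IsGloballyMinimal],
      ClassX11b W 3 → Ram W 3 → ShapeAlpha W → Typed.MissingUpperBoundAt W 3)
    (hUγ : ∀ (W : WeierstrassCurve ℚ) [W.IsElliptic] [W.IsGloballyMinimal],
      ClassX11b W 3 → Ram W 3 → W.HasSplitMultiplicativeReductionAtPrime 3 → ¬ ShapeAlpha W →
        ShapeGamma W → Typed.MissingUpperBoundAt W 3)
    -- ROAD (d) `¬Ram ∧ Surj` (as v4.5′)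
    (hDd : ∀ (W : WeierstrassCurve ℚ) [W.IsElliptic] [W.IsGloballyMinimal],
      ClassX11b W 3 → ¬ Ram W 3 → Surj W 3 → HsiehDescentAt₃ W)
    (hHd : ∀ (W : WeierstrassCurve ℚ) [W.IsElliptic] [W.IsGloballyMinimal],
      ClassX11b W 3 → ¬ Ram W 3 → Surj W 3 → BDPValueAt₃ W ∧ IMCDivAt₃B W)
    (hU₀ : ∀ (W : WeierstrassCurve ℚ) [W.IsElliptic] [W.IsGloballyMinimal],
      ClassX11b W 3 → Surj W 3 → ¬ Ram W 3 → Typed.MissingUpperBoundAt W 3)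
    -- THE (T4″)@3 CORNER (as v4.5′)
    (hCL : ∀ (W : WeierstrassCurve ℚ) [W.IsElliptic] [W.IsGloballyMinimal], CornerStepLAt W)
    (hCW : ∀ (W : WeierstrassCurve ℚ) [W.IsElliptic] [W.IsGloballyMinimal],
      CornerTwistWitness.CornerTwistWitnessAt W)
    (hCU' : CornerAtThreeUpperConsumed) :
    MultiplicativeRankOneAtThree := by
  intro W _ _ hX
  have hEP : ∀ (K : Type) [Field K] [NumberField K] (v : HeightOneSpectrum (𝓞 K)),
      localEulerPoincareCharacteristic (v.adicCompletion K) :=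
    GaloisImage.EP.localEulerPoincareCharacteristic_adicCompletion
  by_cases hram : Ram W 3
  · by_cases htam : 3 ∣ W.tamagawaProduct
    · by_cases hs : W.HasSplitMultiplicativeReductionAtPrime 3
      · -- road (b) on the Tamagawa cells: StepLAt W from the named descent residual + H2 ∧ H3 at W
        have hL : StepLAt W :=
          stepLAt_of_halves₃_of_classX11bB hnf hKo hPT hEP hX
            (bdpExistsAt₃_of_hsieh2014_of_descent W hH lambdaSupplyAt₃ (hDb W hX hram hs))
            (hHb W hX hram hs htam).1 (hHb W hX hram hs htam).2
        exact Three.bsdp_three_of_surj_of_stepLAt_of_shapes_upper hGZ hKo hB hSk hWu hGZK hmod hnf hHL hMaz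
          hPT hEP W hX (surj_of_irr_of_ram W 3 hX.2.2.2 hram) hL
          (fun hram hα hγ ht ↦ hUβ W hX hram hs hα hγ ht) (fun hram hα ↦ hUα W hX hram hα)
          (fun hram hα hγ ↦ hUγ W hX hram hs hα hγ) (fun h ↦ absurd hram h)
      · -- road (a) on the Tamagawa cells
        exact bsdp_of_ram_of_nonsplit_of_regulatorNonvanishing hSkA hJn hHn hD hGZK hpar W 3 hX hram hs
          (hReg W hX hram hs htam)
    · -- A1: the Kolyvagin road decides
      exact hA1 W hX hram htam
  · by_cases hsurj : Surj W 3
    · -- road (d), as v4.5′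
      have hL₀ : StepLAt W :=
        stepLAt_of_halves₃_of_classX11bB hnf hKo hPT hEP hX
          (bdpExistsAt₃_of_hsieh2014_of_descent W hH lambdaSupplyAt₃ (hDd W hX hram hsurj))
          (hHd W hX hram hsurj).1 (hHd W hX hram hsurj).2
      exact Three.bsdp_three_of_surj_of_stepLAt_of_shapes_upper hGZ hKo hB hSk hWu hGZK hmod hnf hHL hMaz
        hPT hEP W hX hsurj hL₀ (fun h _ _ _ ↦ absurd h hram) (fun h _ ↦ absurd h hram)
        (fun h _ _ ↦ absurd h hram) (fun _ ↦ hU₀ W hX hsurj hram)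
    · -- the corner: ONE call at the twin WITNESS (as in §1 of this file)
      refine Typed.bsdp_of_missingPPartAt W 3 hGZK (by rw [hX.1]) ?_
      exact CornerTwistWitness.missingPPartAt_of_corner_of_witness hGZ hKo hGZK hmod hnf hMaz hPT hEP hMN W hX
        hsurj (hCL W) (hCW W) (fun ht ↦ hCU' W hX hsurj ht)


end Summit.BirchSwinnertonDyer.BirchSwinnertonDyer.Theorems

end
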